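import Summits.QuantumFields.BalabanUV.Gaps.CapAvgAFNecessary
import Summits.QuantumFields.BalabanUV.Gaps.CapBlockTransferFloors

/-!
# Gaps / CapBlockTowerWindow — THE TOWER ROAD'S INPUT IS THE WINDOW CURRENCY: (N2)-type window floors ∕ the averaged-AF carrier at ONE small
# block size give THEOREM-2 grade for the `L₀ⁿ`-constructions from an explicit power on, and conversely a block floor at ONE power is a window
# floor (cell pub-balaban-gaps, seat g1-p3 gen 5, CAP+tail «split ∕ weakening» charge; third leaf of the block-tower series after
# `CapBlockTowerEmpty` (rate) and `CapBlockTowerWashout` (eventual rate ∕ eventual floor))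

HONEST FRAMING (cell rule, page 1 of everything): bookkeeping over hypothesis SHAPES of the tree's β sub-cell; NOTHING of Bałaban's is asserted
beyond print; [Balaban1987RG1] Thm 2 is UNPROVED IN PRINT and enters only as hypothesis ∕ conclusion `B12.Thm2Printed C L`; the window floor
`c·n − A ≤ Σ_{j∈[k,k+n)} β⁰_{j+1}` ((N2)'s OUTPUT, `CapSignsNecessary`) and the carrier `BetaAvgAFH s D γ β` (node U2, `Beta.AveragedAFCarrier`)
are HYPOTHESES here; the ONE-LOOP composition hypothesis enters in its weakest load-bearing ONE-SIDED form `hblock : blockSum n b k ≤ S.β0 k`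
(Q-asym1-5 — a BINDER, never asserted; the equality `S.β0 k = blockSum n b k` of `Beta.RateCertificate` §10 and the nearness of §11 imply it;
one-sidedness observed by g1-plan-2, lens L-1 ∕ XREAD X-79 (b)); (D4)
enters as `EverySlope` ∕ `RemainderConst` ∕ `LimitForm`; 0 coefficients certified; 0∕6 binders discharged; one finite T⁴; NOT `BetaPertH`, NOT the
continuum limit, NOT Clay.  HONEST DEPENDENCY (b2b cell, verbatim): «continuum YM on T⁴ ⇐ BetaPertH ∧ nine spine estimates (0/9 proved);
BetaPertH ⇐ (D1) ∧ (D4) ∧ CAP+tail; G-an2-4 gates asym, D1 and NE2/3/4.»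

THE POINT ([folklore] sequence algebra).  A block sum IS a window sum: `blockSum n b k = Σ_{j∈[nk, nk+n)} b_j` (§1).  Hence
§2 a WINDOW FLOOR `∀ k n, c·n − A ≤ Σ_{[k,k+n)} b` (slope `c > 0`, defect `A`) gives `c·n − A ≤ blockSum n b k` for ALL `k`, positive for
   `n ≥ ⌊A∕c⌋₊ + 1` (`blockSums_of_windowFloor_index_le`): the tower road's input is EXACTLY the window currency — no rate, no limit, no sign;
§3 CONVERSELY a uniform floor of the block sums at ONE power `n₀ ≥ 1` (`f ≤ blockSum n₀ b m`, `f ≥ 0`) with a termwise lower bound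
   `−B ≤ b_j` (`B ≥ 0`) IS a window floor with slope `f∕n₀` and defect `2f + 2n₀B` (`windowFloor_of_blockFloor`) — so «Theorem-2-grade input
   at some power of the block size» and «(N2) ∕ averaged-AF window currency at the small block» are ONE datum for sequences bounded below;
§4 ENDs under Q-asym1-5 for the `L₀ⁿ`-construction: **`thm2Printed_of_blockTowerWindow_everySlope`** (window floor at the small block + power
   `≥ ⌊A∕c⌋₊ + 1` + `hblock` + `EverySlope` + (C)(U) ⟹ `B12.Thm2Printed C L'`), `_limitForm`; from the CARRIER: **`thm2Printed_of_blockTower_avgAF`**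
   (`BetaAvgAFH s D γ β` at the small block + `RemainderConst S γ r` with `r < s` — node U2's input, what the [III]-side END consumes — ⟹ (0.31)
   for the `L₀ⁿ`-constructions from `⌊D∕(s−r)⌋₊ + 1` on: the averaged-AF carrier at block size `L₀` IS Theorem-2-grade input up the tower);
§5 THEOREM 2 CLIMBS THE TOWER: `B12.Thm2Printed` for the `L₀`-construction (forward generation, `EverySlope`) ⟹ (N2) ⟹ under `hblock` (0.31)
   for every `L₀ⁿ`-construction from some power on (`exists_towerPower_of_thm2Printed`, `thm2Printed_tower_of_thm2Printed`) — the coarse-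
   graining consistency of the typed (0.31) on the Q-asym1-5 road (for scheme (S1) a triviality; for (S2)∕(S3) it is content of `hblock`).
READING for rows CAP ∕ tail: the tower road relocates the CAP into the window ∕ averaged-AF currency at ONE small block (rows tail ∕ U2) plus
Q-asym1-5 and (D4) at the big block; it asks NO sign at any block size.  0 sorry; 0 def; imports tree files only; restates nothing.

CITATION HEADER (tags CONTEXT ONLY).  [I] = T. Bałaban, Commun. Math. Phys. **109** (1987) [Balaban1987RG1]: Thm 2 p. 259 with (0.31); p. 251
(«L odd > 11»); (1.22) p. 264; (2.12)–(2.14) p. 268.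
-/

namespace Summit.QuantumFields.BalabanUV.Gaps.CapBlockTowerWindow

open Literature.MathematicalPhysics.QuantumFieldTheory.Balaban1983to89
open Literature.MathematicalPhysics.QuantumFieldTheory.Balaban1983to89.FlowStep
open Literature.MathematicalPhysics.QuantumFieldTheory.Balaban1983to89.FlowStepRuns
open Literature.MathematicalPhysics.QuantumFieldTheory.Balaban1983to89.DagBinding
open Literature.MathematicalPhysics.QuantumFieldTheory.Balaban1983to89.Beta.RateCertificate (blockSum)
open Literature.MathematicalPhysics.QuantumFieldTheory.Balaban1983to89.Beta.RemainderChain (RemainderConst)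
open Literature.MathematicalPhysics.QuantumFieldTheory.Balaban1983to89.Beta.AveragedAFCarrier (BetaAvgAFH)
open Summit.QuantumFields.BalabanUV.Gaps.CapSignsConstRoad (EverySlope thm2Printed_of_beta0Floor_everySlope betaAFH_of_beta0Floor_everySlope)
open Summit.QuantumFields.BalabanUV.Gaps.CapSignsNecessaryFwd (beta0_windowSum_lower_of_thm2Printed_fwd)
open Summit.QuantumFields.BalabanUV.Gaps.CapAvgAFNecessary (beta0Window_of_betaAvgAFH_remainderConst)
open Finset

noncomputable section

/-! ## §1 A block sum is a window sum -/

/-- `blockSum n b k = Σ_{j ∈ [nk, nk+n)} b_j`. [folklore] -/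
theorem blockSum_eq_windowSum (n : ℕ) (b : ℕ → ℝ) (k : ℕ) : blockSum n b k = ∑ j ∈ Ico (n * k) (n * k + n), b j := by
  rw [blockSum, Finset.sum_Ico_eq_sum_range, add_tsub_cancel_left]

/-! ## §2 Window floor ⟹ block floors at every power, positive from an explicit power -/

/-- **WINDOW FLOOR ⟹ BLOCK FLOOR**: `∀ k n, c·n − A ≤ Σ_{[k,k+n)} b` ⟹ `c·n − A ≤ blockSum n b k` for all `n, k`. [folklore] -/
theorem blockSum_ge_of_windowFloor {b : ℕ → ℝ} {c A : ℝ} (hw : ∀ k n : ℕ, c * n - A ≤ ∑ j ∈ Ico k (k + n), b j) (n k : ℕ) :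
    c * n - A ≤ blockSum n b k := by
  rw [blockSum_eq_windowSum]; exact hw (n * k) n

/-- The explicit power beats the defect: `0 < c`, `n ≥ ⌊A∕c⌋₊ + 1` ⟹ `0 < c·n − A`. [folklore] -/
theorem windowFloor_pos_of_index_le {c A : ℝ} (hc : 0 < c) {n : ℕ} (hn : ⌊A / c⌋₊ + 1 ≤ n) : 0 < c * n - A := by
  have h1 : A / c < (⌊A / c⌋₊ : ℝ) + 1 := Nat.lt_floor_add_one _
  have h2 : (⌊A / c⌋₊ : ℝ) + 1 ≤ (n : ℝ) := by exact_mod_cast hn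
  have h3 : A / c < n := h1.trans_le h2
  rw [div_lt_iff₀ hc] at h3
  linarith

/-- **ALL BLOCK SUMS POSITIVE FROM THE POWER `⌊A∕c⌋₊ + 1` ON**, from the window floor alone (no rate, no limit, no sign). [folklore] -/
theorem blockSums_of_windowFloor_index_le {b : ℕ → ℝ} {c A : ℝ} (hc : 0 < c)
    (hw : ∀ k n : ℕ, c * n - A ≤ ∑ j ∈ Ico k (k + n), b j) {n : ℕ} (hn : ⌊A / c⌋₊ + 1 ≤ n) :
    0 < c * n - A ∧ ∀ k, c * n - A ≤ blockSum n b k :=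
  ⟨windowFloor_pos_of_index_le hc hn, blockSum_ge_of_windowFloor hw n⟩

/-! ## §3 Conversely: a block floor at ONE power is a window floor -/

/-- Termwise lower bound summed over a window: `−B ≤ b_j` ⟹ `−B·(m' − m) ≤ Σ_{[m,m')} b` (`m ≤ m'`). [folklore] -/
theorem windowSum_ge_neg {b : ℕ → ℝ} {B : ℝ} (hB : ∀ j, -B ≤ b j) (m m' : ℕ) :
    -(B * ((m' - m : ℕ) : ℝ)) ≤ ∑ j ∈ Ico m m', b j := by
  have h1 : ∑ _j ∈ Ico m m', (-B) ≤ ∑ j ∈ Ico m m', b j := sum_le_sum fun j _ => hB j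
  rw [sum_const, Nat.card_Ico, nsmul_eq_mul] at h1
  linarith

/-- Consecutive blocks summed: `Σ_{m₁ ≤ m < m₂} blockSum n₀ b m = Σ_{j ∈ [n₀m₁, n₀m₂)} b_j`. [folklore] -/
theorem sum_blockSum_eq_windowSum (n₀ : ℕ) (b : ℕ → ℝ) {m₁ m₂ : ℕ} (h : m₁ ≤ m₂) :
    ∑ m ∈ Ico m₁ m₂, blockSum n₀ b m = ∑ j ∈ Ico (n₀ * m₁) (n₀ * m₂), b j := by
  induction m₂, h using Nat.le_induction with
  | base => simp
  | succ m₂ hm ih =>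
      rw [Finset.sum_Ico_succ_top hm, ih, blockSum_eq_windowSum, Nat.mul_succ,
        Finset.sum_Ico_consecutive _ (Nat.mul_le_mul_left n₀ hm) (Nat.le_add_right _ _)]

/-- **BLOCK FLOOR AT ONE POWER ⟹ WINDOW FLOOR**: `1 ≤ n₀`, `0 ≤ f ≤ blockSum n₀ b m` for all `m`, `−B ≤ b_j` for all `j` (`0 ≤ B`) ⟹
`∀ k n, (f∕n₀)·n − (2f + 2n₀B) ≤ Σ_{[k,k+n)} b`.  (Split the window at the first and last block boundaries inside it: at least `n∕n₀ − 2` full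
blocks, head and tail of length `< n₀` each.)  With §2: for sequences bounded below, «a positive floor of the block sums at SOME power» and
«a window floor with positive slope» are ONE datum. [folklore] -/
theorem windowFloor_of_blockFloor {b : ℕ → ℝ} {f B : ℝ} {n₀ : ℕ} (hn₀ : 1 ≤ n₀) (hf : 0 ≤ f) (hB : 0 ≤ B)
    (hblock : ∀ m, f ≤ blockSum n₀ b m) (hlo : ∀ j, -B ≤ b j) (k n : ℕ) :
    f / n₀ * n - (2 * f + 2 * n₀ * B) ≤ ∑ j ∈ Ico k (k + n), b j := by
  have hn₀pos : 0 < n₀ := hn₀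
  have hn₀R : (0 : ℝ) < n₀ := by exact_mod_cast hn₀pos
  -- first block boundary ≥ k and last block boundary ≤ k + n
  set m₁ := (k + n₀ - 1) / n₀ with hm₁
  set m₂ := (k + n) / n₀ with hm₂
  have hkm₁ : k ≤ n₀ * m₁ := by
    rw [hm₁]; have := Nat.div_mul_le_self (k + n₀ - 1) n₀
    have h2 : k + n₀ - 1 < (k + n₀ - 1) / n₀ * n₀ + n₀ := Nat.lt_div_mul_add (by omega)
    rw [mul_comm]; omega
  have hm₁k : n₀ * m₁ ≤ k + n₀ - 1 := by rw [hm₁, mul_comm]; exact Nat.div_mul_le_self _ _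
  have hm₂le : n₀ * m₂ ≤ k + n := by rw [hm₂, mul_comm]; exact Nat.div_mul_le_self _ _
  have hm₂gt : k + n < n₀ * m₂ + n₀ := by rw [hm₂, mul_comm]; exact Nat.lt_div_mul_add hn₀pos
  have hBn₀ : 0 ≤ (n₀ : ℝ) * B := by positivity
  -- head and tail pieces are shorter than one block
  have hheadLen : ((n₀ * m₁ - k : ℕ) : ℝ) ≤ n₀ := by
    have : n₀ * m₁ - k ≤ n₀ := by omega
    exact_mod_cast this
  have htailLen : ((k + n - n₀ * m₂ : ℕ) : ℝ) ≤ n₀ := by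
    have : k + n - n₀ * m₂ ≤ n₀ := by omega
    exact_mod_cast this
  rcases le_or_gt m₁ m₂ with hle | hgt
  · -- window = head ∪ middle ∪ tail
    have hsplit : ∑ j ∈ Ico k (k + n), b j =
        ∑ j ∈ Ico k (n₀ * m₁), b j + ∑ j ∈ Ico (n₀ * m₁) (n₀ * m₂), b j + ∑ j ∈ Ico (n₀ * m₂) (k + n), b j := by
      rw [Finset.sum_Ico_consecutive _ hkm₁ (Nat.mul_le_mul_left n₀ hle),
        Finset.sum_Ico_consecutive _ (hkm₁.trans (Nat.mul_le_mul_left n₀ hle)) hm₂le]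
    have hmid : ((m₂ : ℝ) - m₁) * f ≤ ∑ j ∈ Ico (n₀ * m₁) (n₀ * m₂), b j := by
      rw [← sum_blockSum_eq_windowSum n₀ b hle]
      have h1 : ∑ _m ∈ Ico m₁ m₂, f ≤ ∑ m ∈ Ico m₁ m₂, blockSum n₀ b m := sum_le_sum fun m _ => hblock m
      rw [sum_const, Nat.card_Ico, nsmul_eq_mul, Nat.cast_sub hle] at h1
      linarith
    have hhead : -((n₀ : ℝ) * B) ≤ ∑ j ∈ Ico k (n₀ * m₁), b j :=
      le_trans (by nlinarith) (windowSum_ge_neg hlo k (n₀ * m₁))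
    have htail : -((n₀ : ℝ) * B) ≤ ∑ j ∈ Ico (n₀ * m₂) (k + n), b j :=
      le_trans (by nlinarith) (windowSum_ge_neg hlo (n₀ * m₂) (k + n))
    -- number of full blocks ≥ n/n₀ − 2 (from n₀m₁ ≤ k + n₀ − 1 and k + n < n₀m₂ + n₀)
    have hA : (n₀ : ℝ) * m₁ ≤ k + n₀ := by
      have : n₀ * m₁ ≤ k + n₀ := by omega
      exact_mod_cast this
    have hBd : (k : ℝ) + n ≤ n₀ * m₂ + n₀ := by exact_mod_cast hm₂gt.le
    have hcount : (n : ℝ) / n₀ - 2 ≤ (m₂ : ℝ) - m₁ := by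
      have h := (div_le_iff₀ hn₀R).mpr (show (n : ℝ) ≤ ((m₂ : ℝ) - m₁ + 2) * n₀ by nlinarith)
      linarith
    have hmid' : f / n₀ * n - 2 * f ≤ ∑ j ∈ Ico (n₀ * m₁) (n₀ * m₂), b j := by
      have e : f / n₀ * n - 2 * f = ((n : ℝ) / n₀ - 2) * f := by ring
      rw [e]
      exact (mul_le_mul_of_nonneg_right hcount hf).trans hmid
    rw [hsplit]; linarith
  · -- m₂ < m₁: the window is shorter than one block, n < n₀
    have hn : n < n₀ := by
      by_contra hge
      have : m₁ ≤ m₂ := by rw [hm₁, hm₂]; exact Nat.div_le_div_right (by omega)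
      omega
    have hw : -(B * ((k + n - k : ℕ) : ℝ)) ≤ ∑ j ∈ Ico k (k + n), b j := windowSum_ge_neg hlo k (k + n)
    rw [add_tsub_cancel_left] at hw
    have hnR : (n : ℝ) ≤ n₀ := by exact_mod_cast hn.le
    have h1 : f / n₀ * n ≤ f := by
      rw [div_mul_eq_mul_div, div_le_iff₀ hn₀R]; exact mul_le_mul_of_nonneg_left hnR hf
    have h2 : -((n₀ : ℝ) * B) ≤ -(B * n) := by nlinarith
    linarith

/-! ## §4 ENDs for the `L₀ⁿ`-construction under Q-asym1-5: window floor ∕ averaged-AF carrier at the small block -/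

variable {β : HBeta}

/-- **[Balaban1987RG1] THEOREM 2 AS PRINTED FOR THE `L₀ⁿ`-CONSTRUCTION FROM A WINDOW FLOOR AT THE SMALL BLOCK, every-slope road**: forward
generation; a window floor `c·n − A ≤ Σ_{[k,k+n)} b` (`c > 0`) of the SMALL-block one-loop coefficients ((N2)'s currency); the power
`n ≥ ⌊A∕c⌋₊ + 1`; the one-loop composition hypothesis in its weakest load-bearing, ONE-SIDED form `hblock : blockSum n b k ≤ S.β0 k`
(Q-asym1-5, a binder; the equality and the `NearRate` forms imply it — g1-plan-2 lens L-1 ∕ X-79 (b)); `EverySlope S γc`, (C), (U) for the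
big construction ⟹
`B12.Thm2Printed C L'` — no rate, no limit value, no sign (`CapSignsConstRoad.thm2Printed_of_beta0Floor_everySlope` on the floor `c·n − A`).
[cite: Balaban1987RG1, Thm 2 p.259 with (0.31) and (1.22) p.264] -/
theorem thm2Printed_of_blockTowerWindow_everySlope {C : B12.Construction} (hgen : ForwardGenerated C β) {L' : ℝ} (hL : 1 < L')
    (S : B12Beta.OneLoopSplit β) {b : ℕ → ℝ} {n : ℕ} (hblock : ∀ k, blockSum n b k ≤ S.β0 k) {c A γc β' : ℝ} (hc : 0 < c)
    (hw : ∀ k n : ℕ, c * n - A ≤ ∑ j ∈ Ico k (k + n), b j) (hn : ⌊A / c⌋₊ + 1 ≤ n)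
    (hrem : EverySlope S γc) (hcont : BetaContH γc β) (hup : BetaUpperH β' γc β) : B12.Thm2Printed C L' := by
  obtain ⟨hpos, hF⟩ := blockSums_of_windowFloor_index_le hc hw hn
  exact thm2Printed_of_beta0Floor_everySlope hgen hL S hpos (fun k => (hF k).trans (hblock k)) hrem hcont hup

/-- `BetaAFH β` for the big construction from the small-block window floor, the power and `hblock` + `EverySlope`. [folklore] -/
theorem betaAFH_of_blockTowerWindow_everySlope (S : B12Beta.OneLoopSplit β) {b : ℕ → ℝ} {n : ℕ}
    (hblock : ∀ k, blockSum n b k ≤ S.β0 k) {c A γc : ℝ} (hc : 0 < c) (hw : ∀ k n : ℕ, c * n - A ≤ ∑ j ∈ Ico k (k + n), b j)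
    (hn : ⌊A / c⌋₊ + 1 ≤ n) (hrem : EverySlope S γc) : BetaAFH β := by
  obtain ⟨hpos, hF⟩ := blockSums_of_windowFloor_index_le hc hw hn
  exact betaAFH_of_beta0Floor_everySlope S hpos (fun k => (hF k).trans (hblock k)) hrem

/-- The same on the LIMIT-FORM road of the big construction (every sign the CAP could ask is supplied; `CapTailSigns.thm2Printed_of_signs`).
[cite: Balaban1987RG1, Thm 2 p.259 with (0.31) and (1.22) p.264] -/
theorem thm2Printed_of_blockTowerWindow_limitForm (D : Beta.Assembly.LimitForm β) {C : B12.Construction} (hgen : ForwardGenerated C β)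
    {L' : ℝ} (hL : 1 < L') {b : ℕ → ℝ} {n : ℕ} (hblock : ∀ k, blockSum n b k ≤ D.S.β0 k) {c A : ℝ} (hc : 0 < c)
    (hw : ∀ k n : ℕ, c * n - A ≤ ∑ j ∈ Ico k (k + n), b j) (hn : ⌊A / c⌋₊ + 1 ≤ n) : B12.Thm2Printed C L' := by
  obtain ⟨hpos, hF⟩ := blockSums_of_windowFloor_index_le hc hw hn
  exact CapTailSigns.thm2Printed_of_signs D hgen hL fun k _ => hpos.trans_le ((hF k).trans (hblock k))

/-- **FROM THE AVERAGED-AF CARRIER AT THE SMALL BLOCK** (node U2's input; what the [III]-side END consumes): `BetaAvgAFH s D γ β₀` for the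
SMALL-block β-family `β₀` with split `S₀` and `RemainderConst S₀ γ r` (`0 < γ`, `r < s`) give the window floor with slope `s − r`
(`CapAvgAFNecessary.beta0Window_of_betaAvgAFH_remainderConst`); so with the one-sided one-loop composition hypothesis `hblock : blockSum n S₀.β0 k ≤ S.β0 k`
for the BIG construction's split `S`, the power `n ≥ ⌊D∕(s−r)⌋₊ + 1`, `EverySlope S γc`, (C), (U), forward generation: `B12.Thm2Printed C L'`.
The averaged-AF carrier at block size `L₀` IS Theorem-2-grade input up the tower. [cite: Balaban1987RG1, Thm 2 p.259 with (0.31) and (1.22) p.264] -/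
theorem thm2Printed_of_blockTower_avgAF {β₀ : HBeta} (S₀ : B12Beta.OneLoopSplit β₀) {s D γ r : ℝ} (hγ : 0 < γ)
    (h : BetaAvgAFH s D γ β₀) (hrem₀ : RemainderConst S₀ γ r) (hrs : r < s)
    {C : B12.Construction} (hgen : ForwardGenerated C β) {L' : ℝ} (hL : 1 < L') (S : B12Beta.OneLoopSplit β) {n : ℕ}
    (hblock : ∀ k, blockSum n S₀.β0 k ≤ S.β0 k) (hn : ⌊D / (s - r)⌋₊ + 1 ≤ n) {γc β' : ℝ}
    (hrem : EverySlope S γc) (hcont : BetaContH γc β) (hup : BetaUpperH β' γc β) : B12.Thm2Printed C L' :=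
  thm2Printed_of_blockTowerWindow_everySlope hgen hL S hblock (sub_pos.mpr hrs)
    (beta0Window_of_betaAvgAFH_remainderConst S₀ hγ h hrem₀) hn hrem hcont hup

/-! ## §5 Theorem 2 climbs the tower -/

/-- **THEOREM 2 CLIMBS THE TOWER** (on the Q-asym1-5 road): `B12.Thm2Printed C₀ L₀` for a SMALL-block construction `C₀` forward-generated by
`β₀` with split `S₀` and `EverySlope S₀ γ₀` ⟹ ((N2), `CapSignsNecessaryFwd.beta0_windowSum_lower_of_thm2Printed_fwd`) a window floor of `S₀.β0`
with positive slope ⟹ there is a power `n₁` such that for EVERY `n ≥ n₁` and every big construction `C` forward-generated by a `β` whose split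
`S` satisfies the one-sided `hblock : blockSum n S₀.β0 k ≤ S.β0 k`, with `EverySlope S γc`, (C), (U): `B12.Thm2Printed C L'`.  For scheme (S1) (re-indexing)
this is the expected coarse-graining consistency of the typed (0.31); for (S2)∕(S3) it is content of `hblock`. [cite: Balaban1987RG1, Thm 2 p.259 with (0.31) and (1.22) p.264] -/
theorem thm2Printed_tower_of_thm2Printed {β₀ : HBeta} {C₀ : B12.Construction} (hgen₀ : ForwardGenerated C₀ β₀)
    (S₀ : B12Beta.OneLoopSplit β₀) {γ₀ : ℝ} (hrem₀ : EverySlope S₀ γ₀) {L₀ : ℝ} (hL₀ : 1 < L₀) (h : B12.Thm2Printed C₀ L₀) :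
    ∃ n₁ : ℕ, ∀ n, n₁ ≤ n → ∀ {C : B12.Construction}, ForwardGenerated C β → ∀ (S : B12Beta.OneLoopSplit β),
      (∀ k, blockSum n S₀.β0 k ≤ S.β0 k) → ∀ {γc β' L' : ℝ}, EverySlope S γc → BetaContH γc β → BetaUpperH β' γc β →
        1 < L' → B12.Thm2Printed C L' := by
  obtain ⟨c, hc, A, hw⟩ := beta0_windowSum_lower_of_thm2Printed_fwd hgen₀ S₀ hrem₀ hL₀ h
  exact ⟨⌊A / c⌋₊ + 1, fun n hn C hgen S hblock γc β' L' hrem hcont hup hL =>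
    thm2Printed_of_blockTowerWindow_everySlope hgen hL S hblock hc hw hn hrem hcont hup⟩

/-- Sequence-level form: (0.31) for the small construction ⟹ SOME power from which on all block sums of its one-loop coefficients are positive
(with an explicit floor `c·n − A`). [cite: Balaban1987RG1, Thm 2 p.259 with (0.31)] -/
theorem exists_towerPower_of_thm2Printed {β₀ : HBeta} {C₀ : B12.Construction} (hgen₀ : ForwardGenerated C₀ β₀)
    (S₀ : B12Beta.OneLoopSplit β₀) {γ₀ : ℝ} (hrem₀ : EverySlope S₀ γ₀) {L₀ : ℝ} (hL₀ : 1 < L₀) (h : B12.Thm2Printed C₀ L₀) :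
    ∃ n₁ : ℕ, ∀ n, n₁ ≤ n → ∀ k, 0 < blockSum n S₀.β0 k := by
  obtain ⟨c, hc, A, hw⟩ := beta0_windowSum_lower_of_thm2Printed_fwd hgen₀ S₀ hrem₀ hL₀ h
  exact ⟨⌊A / c⌋₊ + 1, fun n hn k => by
    obtain ⟨hpos, hF⟩ := blockSums_of_windowFloor_index_le hc hw hn
    exact hpos.trans_le (hF k)⟩

end

end Summit.QuantumFields.BalabanUV.Gaps.CapBlockTowerWindow
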